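import Summits.AtomisticToContinuum.FouriersLaw.Theorems.OddSectorIrreversibilityConeScaleCorrectorStubConeTransportBudget
import Summits.AtomisticToContinuum.FouriersLaw.Theorems.OddSectorIrreversibilityCorrectorResponseNonneg
import Summits.AtomisticToContinuum.FouriersLaw.Theorems.OddSectorIrreversibilityCorrectorTheoryUniformMixing

/-!
# `ConeScaleCorrector` (E1): the Kubo–Abel obstruction — pointwise forecast decorrelation already IS bounded response

Support file for crux stmt-AtomisticToContinuum-14069 (`OddSectorIrreversibility.ConeScaleCorrector`, E1). The
crux-strategist's census (`Cruxes/ConeScaleCorrector/STRATEGY-CENSUS.md` §3 (v), §4 "the KuboAbel obstruction")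
explains why no time-LOCAL decorrelation leaf can be both a piece of E1 and weaker than the route's target: the
typed strengthening (A2) `ForecastDecorrelation` of `StrategistSketch.lean` —

  `∃ ρ ≥ 0, ∫_{[0,∞)} ρ ≤ R : ⟨P_sJ, P_tJ⟩_{μ_T} ≤ ρ(t − s)·‖P_sJ‖²_{μ_T}` for `0 ≤ s ≤ t`, every `N`

— evaluated at `s = 0` bounds the equilibrium current autocorrelation `c_N(t) = ⟨J, P_tJ⟩` by `ρ(t)‖J‖²`, hence
the open-chain Green–Kubo integral `∫₀^∞ c_N ≤ R‖J‖² ≤ R·K·N·Z` (landed `N`-uniform statics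
`exists_const_currentNormSq_le`), and the LANDED Kubo–Abel identity `(N−1)T²D_N = ∫₀^∞ c_N dπ` (conjunct B of the
PROVED `CorrectorTheory`) turns this into `D_N ≤ 2KR/T²`: **`ForecastDecorrelation → BoundedResponse`**
(`boundedResponse_of_forecastDecorrelation`, this file; lower side `0 ≤ D_N` is the landed
`response_nonneg_of_correctorTheory`). So (A2) proves the consequent of the route's transport-witness theorem
`WitnessGlue` BY ITSELF, making E2, P and E1 redundant — it is a rival one-crux thesis of summit strength, not a
decomposition leaf of E1. The census recorded this in prose ("≈ 30 lines over `CorrectorTheory` B +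
`exists_const_currentNormSq_le`"); here it is a theorem, with (A2) stated VERBATIM (the typed object of
`StrategistSketch.lean`, inlined as the hypothesis — no `def`).

No definitions; conditional on nothing open (CorrectorTheory is proved: `Corrector.CorrectorTheory_proof`); nothing
here closes an item.
-/

noncomputable section

open MeasureTheory Filter Topology Set
open scoped ENNReal NNReal
open Literature.MathematicalPhysics.KineticTheory.HeatConduction
open Literature.MathematicalPhysics.KineticTheory.OddSectorLocality

namespace Summit.AtomisticToContinuum.FouriersLaw.Theorems.OddSectorIrreversibility

/-- **The Kubo–Abel obstruction: `ForecastDecorrelation → BoundedResponse`.** A pointwise-in-time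
decorrelation envelope `⟨P_sJ, P_tJ⟩_{μ_T} ≤ ρ(t−s)‖P_sJ‖²` with `ρ ≥ 0`, `∫_{[0,∞)} ρ ≤ R` (uniform in `N`) gives,
at `s = 0`, `c_N(t) ≤ ρ(t)·‖J‖²_{μ_T} ≤ ρ(t)·K·N·Z`; integrating and dividing by `Z`,
`(N−1)T²D_N = ∫₀^∞ c_N dπ ≤ K·R·N` (Kubo–Abel identity of the proved `CorrectorTheory`), so `D_N ≤ 2KR/T²` for
`N ≥ 2`; with `0 ≤ D_N` (`response_nonneg_of_correctorTheory`) this is the route's shared target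
`BoundedResponse`. [folklore] -/
theorem boundedResponse_of_forecastDecorrelation :
    (∀ ω₂ lam β γ : ℝ, 0 < ω₂ → 0 < lam → 0 < β → 0 < γ → ∀ T : ℝ, 0 < T →
      ∃ (ρ : ℝ → ℝ) (R : ℝ), (∀ r, 0 ≤ ρ r) ∧ MeasureTheory.IntegrableOn ρ (Set.Ici 0) ∧
        ∫ r in Set.Ici (0 : ℝ), ρ r ≤ R ∧
        ∀ (N : ℕ) (s t : ℝ), 0 ≤ s → s ≤ t →
          ∫ x, Literature.MathematicalPhysics.KineticTheory.OddSectorLocality.currentForecast ω₂ lam β γ T N s x *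
              Literature.MathematicalPhysics.KineticTheory.OddSectorLocality.currentForecast ω₂ lam β γ T N t x
              ∂(Literature.MathematicalPhysics.KineticTheory.OddSectorLocality.gibbsWeight ω₂ lam β γ T N)
            ≤ ρ (t - s) * Literature.MathematicalPhysics.KineticTheory.OddSectorLocality.forecastNormSq ω₂ lam β γ T N s) →
    Summit.AtomisticToContinuum.FouriersLaw.Theses.OddSectorIrreversibility.BoundedResponse := by
  intro hA2
  refine boundedResponse_of_correctorTheory_of_eventually_le Corrector.CorrectorTheory_proof ?_
  intro ω₂ lam β γ hω hl hβ hγ hU μ hμ T hT D hD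
  obtain ⟨ρ, R, hρ0, hρint, hρR, hdec⟩ := hA2 ω₂ lam β γ hω hl hβ hγ T hT
  obtain ⟨K, hK0, hK⟩ := exists_const_currentNormSq_le hω hl.le hβ.le γ hT
  refine ⟨2 * K * R / T ^ 2, ?_⟩
  filter_upwards [eventually_ge_atTop 2] with N hN
  -- the Kubo–Abel identity (conjunct B of the proved `CorrectorTheory`)
  have hB := Corrector.CorrectorTheory_proof.2 ω₂ lam β γ hω hl hβ hγ hU μ hμ T hT N (D N) (hD N)
  dsimp only at hB
  obtain ⟨hint, hKubo⟩ := hB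
  -- the mass `Z > 0` and `μ_T = Z • π`
  have hZpos : 0 < ∫ x, Real.exp (-((pinnedChain ω₂ lam β γ).hamiltonian N x) / T) :=
    integral_exp_pos (pinnedChain_integrable_gibbsDensity hω hl.le hβ.le γ N hT)
  have hsmul := gibbsWeight_eq_smul_gibbsMeasure hω hl.le hβ.le γ N hT
  have hZreal := toReal_partitionFunction_eq hω hl.le hβ.le γ N hT
  -- pointwise: `c_N(t) ≤ ρ(t)·K·N` over the Gibbs probability measure, for `t ≥ 0`
  have hpt : ∀ t : ℝ, 0 ≤ t →
      ∫ z, (∑ i : Fin N, (pinnedChain ω₂ lam β γ).bondCurrent N i z) *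
          (∫ y, (∑ i : Fin N, (pinnedChain ω₂ lam β γ).bondCurrent N i y)
            ∂((pinnedChain ω₂ lam β γ).transitionKernel N T T t.toNNReal z))
          ∂((pinnedChain ω₂ lam β γ).gibbsMeasure N T) ≤ ρ t * (K * N) := by
    intro t ht
    have h1 := hdec N 0 t le_rfl ht
    rw [sub_zero, forecastNormSq_zero hω hl.le hβ.le hγ.le] at h1
    have h2 : ρ t * currentNormSq ω₂ lam β γ T N ≤
        ρ t * (K * N * ∫ x, Real.exp (-((pinnedChain ω₂ lam β γ).hamiltonian N x) / T)) :=
      mul_le_mul_of_nonneg_left (hK N) (hρ0 t)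
    -- rewrite the left side over `π`
    have h3 : ∫ x, currentForecast ω₂ lam β γ T N 0 x * currentForecast ω₂ lam β γ T N t x
        ∂(gibbsWeight ω₂ lam β γ T N) =
        (∫ x, Real.exp (-((pinnedChain ω₂ lam β γ).hamiltonian N x) / T)) *
          ∫ z, (∑ i : Fin N, (pinnedChain ω₂ lam β γ).bondCurrent N i z) *
            (∫ y, (∑ i : Fin N, (pinnedChain ω₂ lam β γ).bondCurrent N i y)
              ∂((pinnedChain ω₂ lam β γ).transitionKernel N T T t.toNNReal z))
            ∂((pinnedChain ω₂ lam β γ).gibbsMeasure N T) := by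
      rw [hsmul, integral_smul_measure, smul_eq_mul, hZreal]
      congr 1
      refine integral_congr_ae (Eventually.of_forall fun z => ?_)
      simp only [currentForecast_zero hω hl.le hβ.le hγ.le]
      rfl
    rw [h3] at h1
    have h4 : (∫ x, Real.exp (-((pinnedChain ω₂ lam β γ).hamiltonian N x) / T)) *
          ∫ z, (∑ i : Fin N, (pinnedChain ω₂ lam β γ).bondCurrent N i z) *
            (∫ y, (∑ i : Fin N, (pinnedChain ω₂ lam β γ).bondCurrent N i y)
              ∂((pinnedChain ω₂ lam β γ).transitionKernel N T T t.toNNReal z))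
            ∂((pinnedChain ω₂ lam β γ).gibbsMeasure N T) ≤
        (∫ x, Real.exp (-((pinnedChain ω₂ lam β γ).hamiltonian N x) / T)) * (ρ t * (K * N)) := by
      calc _ ≤ ρ t * (K * N * ∫ x, Real.exp (-((pinnedChain ω₂ lam β γ).hamiltonian N x) / T)) :=
            h1.trans h2
        _ = _ := by ring
    exact le_of_mul_le_mul_left h4 hZpos
  -- integrate over `(0, ∞)`
  have hρint' : IntegrableOn (fun t => ρ t * (K * N)) (Set.Ioi 0) :=
    (hρint.mono_set Ioi_subset_Ici_self).mul_const _
  have hGK : ∫ t in Ioi (0 : ℝ), ∫ z, (∑ i : Fin N, (pinnedChain ω₂ lam β γ).bondCurrent N i z) *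
        (∫ y, (∑ i : Fin N, (pinnedChain ω₂ lam β γ).bondCurrent N i y)
          ∂((pinnedChain ω₂ lam β γ).transitionKernel N T T t.toNNReal z))
        ∂((pinnedChain ω₂ lam β γ).gibbsMeasure N T) ≤ K * N * R := by
    calc _ ≤ ∫ t in Ioi (0 : ℝ), ρ t * (K * N) :=
          setIntegral_mono_on hint hρint' measurableSet_Ioi (fun t ht => hpt t (le_of_lt ht))
      _ = (∫ t in Ioi (0 : ℝ), ρ t) * (K * N) := by rw [integral_mul_const]
      _ ≤ (∫ t in Ici (0 : ℝ), ρ t) * (K * N) := by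
          refine mul_le_mul_of_nonneg_right ?_ (by positivity)
          exact setIntegral_mono_set hρint (Eventually.of_forall fun t => hρ0 t)
            (Eventually.of_forall Ioi_subset_Ici_self)
      _ ≤ R * (K * N) := mul_le_mul_of_nonneg_right hρR (by positivity)
      _ = K * N * R := by ring
  -- `(N−1) T² D_N ≤ K N R` ⟹ `D_N ≤ 2KR/T²`
  have h6 : ((N : ℝ) - 1) * T ^ 2 * D N ≤ K * N * R := hKubo.trans_le hGK
  have hN2 : (2 : ℝ) ≤ N := by exact_mod_cast hN
  have hN1 : (0 : ℝ) < (N : ℝ) - 1 := by linarith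
  have hT2 : (0 : ℝ) < T ^ 2 := by positivity
  have hR0 : 0 ≤ R := le_trans (setIntegral_nonneg measurableSet_Ici fun t _ => hρ0 t) hρR
  have hKR : 0 ≤ K * R := mul_nonneg hK0 hR0
  rw [le_div_iff₀ hT2]
  -- `D N * T² ≤ 2 K R` from `(N-1) T² D N ≤ K N R` and `N ≤ 2 (N - 1)`
  have h5 : ((N : ℝ) - 1) * (D N * T ^ 2) ≤ ((N : ℝ) - 1) * (2 * K * R) := by
    have : K * (N : ℝ) * R ≤ ((N : ℝ) - 1) * (2 * K * R) := by nlinarith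
    calc ((N : ℝ) - 1) * (D N * T ^ 2) = ((N : ℝ) - 1) * T ^ 2 * D N := by ring
      _ ≤ K * N * R := h6
      _ ≤ _ := this
  exact le_of_mul_le_mul_left h5 hN1

end Summit.AtomisticToContinuum.FouriersLaw.Theorems.OddSectorIrreversibility

end
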